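import Mathlib
import Summits.NavierStokesRegularity.FluidComputer.AbcLatticeEigenSynthesis
import HarnessLib

/-!
# Reality of the ABC lattice operator: the cross-product form commutes with the conjugation
# `(Jc)(k) = conj c(−k)` ((F4) «the operator is real», operator half; ASSEMBLY notes (A4)/(A5) of
# `HOME/instab4/KERNEL-CHAIN.md`; instab4 g5 — implementation 2 of the X0 chain, cell `ns-blowup`,
# 2026-08-26)

HONEST FRAMING (human ruling D-0035): nothing here is a claim about Navier–Stokes blow-up.
WHAT THIS IS NOT: not NS evidence; MODEL lane (linearisation of forced Navier–Stokes about the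
exact steady ABC state, certifier units `L_R c(k) = −(1/R)|k|²c(k) + Π_k X c(k)`,
`X c(k) = Σ_{s∈{±e_j}} Û(s) × (i(k−s) × c(k−s) − c(k−s))`). No certificate is moved by this file.
Both X0 certifiers assemble REAL matrices (cert.py in the orbit-pair basis, i3cert in Craya frames)
and the abstract chain uses a real structure twice: `SkewCutSchurCoercivity.exists_eigenvalue_of_certificate`
(«real eigenvector») and `SkewCutGalerkinReality.shell_ineq_of_real_form` ((F4)/(V5): a real
quadratic-form test suffices). The operator-level content of «real» is that `X` — hence `L_R` —
commutes with the conjugation `J`, `(Jc)(k) = conj c(−k)`, whose fixed points are the coefficient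
families of REAL vector fields (`IsConjSymm`):

* §1 `cross_term_conj` — the vector identity `Û × (i q × w̄ − w̄) = conj( conj Û × (i(−q) × w − w) )`.
* §2 `crossForm_conj` — `X(Jc)(k) = conj (X c)(−k)` for EVERY family `c` (any `A, B, C`; reality
  `Û(−s) = conj Û(s)` of the flow, `Torus.isConjSymm_abcCoeff`, and `s ↦ −s` on the shell).
* §3 `isConjSymm_crossForm` — `X` maps conjugate-symmetric (real) families to conjugate-symmetric
  families; `certifierOp_conj` — the whole operator `(x − L_R)` commutes with `J`
  (`SteadyLattice.lerayCoeff_neg_conjVec`, `|−k|² = |k|²`); `certifier_eigen_conj` — if `c` solves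
  `−(|k|²/R)c + ΠXc = λc` then `Jc` solves it with `conj λ` (non-real eigenvalues pair up; a real
  eigenvalue has the conjugate-symmetric eigenfamilies `c + Jc`, `i(c − Jc)`).
* §4 `crossForm_add` / `crossForm_smul` / `crossForm_sub` (linearity of `X` in `c`),
  `isConjSymm_add_conj`, `isConjSymm_I_smul_sub_conj`, `add_conj_ne_zero_or`, and
  `exists_isConjSymm_eigenfamily` — a REAL eigenvalue of the certifiers' operator with a non-zero
  eigenfamily has a non-zero CONJUGATE-SYMMETRIC (real-field) eigenfamily.

Mathlib + the files named; no new definitions, no named facts.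
-/

noncomputable section

open scoped BigOperators ComplexConjugate Matrix
open Filter Set Function MeasureTheory UnitAddTorus

namespace Summit.NavierStokesRegularity.FluidComputer.AbcLatticeReality

open Literature.Analysis.FunctionSpaces Literature.Analysis.FunctionSpaces.Torus
open Literature.Analysis.FunctionSpaces.EuclideanSpace
open Literature.Analysis.FluidPDE Literature.Analysis.FluidPDE.ScalarFourier
open Literature.Analysis.FluidPDE.SteadyLattice
open AbcLatticeEigenSynthesis

/-! ## §1 The pointwise identity -/

/-- Conjugating one cross-form term: `u × (i q × w̄ − w̄) = conj( ū × (i(−q) × w − w) )` in `ℂ³`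
(`q ∈ ℤ³` real; `conj i = −i`). [folklore] -/
theorem cross_term_conj (u w : EuclideanSpace ℂ (Fin 3)) (q : Fin 3 → ℤ) :
    (WithLp.toLp 2 (crossProduct (WithLp.ofLp u)
        (Complex.I • crossProduct (fun j => ((q j : ℤ) : ℂ)) (WithLp.ofLp (conjVec w)) -
          WithLp.ofLp (conjVec w))) : EuclideanSpace ℂ (Fin 3)) =
      conjVec (WithLp.toLp 2 (crossProduct (WithLp.ofLp (conjVec u))
        (Complex.I • crossProduct (fun j => (((-q) j : ℤ) : ℂ)) (WithLp.ofLp w) - WithLp.ofLp w))) := by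
  ext p
  simp only [conjVec_apply, cross_apply, Pi.neg_apply, Int.cast_neg]
  fin_cases p <;> simp [conjVec_apply] <;> ring

/-! ## §2 `X` commutes with the conjugation `J` -/

/-- **`X (J c) = J (X c)`**: for every family `c : ℤ³ → ℂ³` and every `k`,
`Σ_s Û(s) × (i(k−s) × conj c(−(k−s)) − conj c(−(k−s))) = conj( Σ_s Û(s) × (i(−k−s) × c(−k−s) − c(−k−s)) )`
(any `A, B, C`). -/
theorem crossForm_conj (A B C : ℝ) (c : (Fin 3 → ℤ) → EuclideanSpace ℂ (Fin 3)) (k : Fin 3 → ℤ) :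
    (∑ s ∈ Torus.abcFreq, (WithLp.toLp 2 (crossProduct (WithLp.ofLp (Torus.abcCoeff A B C s))
        (Complex.I • crossProduct (fun j => (((k - s) j : ℤ) : ℂ)) (WithLp.ofLp (conjVec (c (-(k - s))))) -
          WithLp.ofLp (conjVec (c (-(k - s)))))) : EuclideanSpace ℂ (Fin 3))) =
      conjVec (∑ s ∈ Torus.abcFreq, (WithLp.toLp 2 (crossProduct (WithLp.ofLp (Torus.abcCoeff A B C s))
        (Complex.I • crossProduct (fun j => (((-k - s) j : ℤ) : ℂ)) (WithLp.ofLp (c (-k - s))) -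
          WithLp.ofLp (c (-k - s)))) : EuclideanSpace ℂ (Fin 3))) := by
  rw [conjVec_sum]
  -- reindex the right-hand side by `s ↦ −s`
  refine Finset.sum_equiv (Equiv.neg (Fin 3 → ℤ)) (fun s => ?_) (fun s hs => ?_)
  · constructor
    · intro hs; exact Torus.neg_mem_abcFreq s hs
    · intro hs; simpa using Torus.neg_mem_abcFreq (-s) hs
  · rw [Equiv.neg_apply]
    have h1 : -k - -s = -(k - s) := by abel
    rw [h1, Torus.isConjSymm_abcCoeff A B C s]
    exact cross_term_conj (Torus.abcCoeff A B C s) (c (-(k - s))) (k - s)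

/-! ## §3 Consequences: real families, the real operator, conjugate eigenpairs -/

/-- **`X` preserves reality**: if `c` is conjugate-symmetric (`c(−k) = conj c(k)`, the coefficient
family of a real field) then so is `k ↦ X c(k)`. -/
theorem isConjSymm_crossForm (A B C : ℝ) {c : (Fin 3 → ℤ) → EuclideanSpace ℂ (Fin 3)}
    (hc : IsConjSymm c) :
    IsConjSymm (fun k => ∑ s ∈ Torus.abcFreq, (WithLp.toLp 2 (crossProduct
        (WithLp.ofLp (Torus.abcCoeff A B C s))
        (Complex.I • crossProduct (fun j => (((k - s) j : ℤ) : ℂ)) (WithLp.ofLp (c (k - s))) -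
          WithLp.ofLp (c (k - s)))) : EuclideanSpace ℂ (Fin 3))) := by
  intro k
  have hJ : ∀ m : Fin 3 → ℤ, conjVec (c (-m)) = c m := fun m => by
    rw [hc m, conjVec_conjVec]
  have h := crossForm_conj A B C c (-k)
  simp only [hJ, neg_neg] at h
  simpa only [neg_neg] using h

/-- **The certifiers' operator is real**: `(x − L_R)(Jc)(k) = conj ((x − L_R) c)(−k)` for real `x`,
i.e. `J` commutes with `c ↦ (x + |k|²/R) c − Π X c` (`Π_{−k} conj = conj Π_k`,
`SteadyLattice.lerayCoeff_neg_conjVec`; any `A, B, C`, any real `R`). -/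
theorem certifierOp_conj (A B C R x : ℝ) (c : (Fin 3 → ℤ) → EuclideanSpace ℂ (Fin 3)) (k : Fin 3 → ℤ) :
    ((x + freqNormSq k / R : ℝ) : ℂ) • conjVec (c (-k)) -
        Torus.lerayCoeff k (∑ s ∈ Torus.abcFreq, (WithLp.toLp 2 (crossProduct
          (WithLp.ofLp (Torus.abcCoeff A B C s))
          (Complex.I • crossProduct (fun j => (((k - s) j : ℤ) : ℂ)) (WithLp.ofLp (conjVec (c (-(k - s))))) -
            WithLp.ofLp (conjVec (c (-(k - s)))))) : EuclideanSpace ℂ (Fin 3))) =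
      conjVec (((x + freqNormSq (-k) / R : ℝ) : ℂ) • c (-k) -
        Torus.lerayCoeff (-k) (∑ s ∈ Torus.abcFreq, (WithLp.toLp 2 (crossProduct
          (WithLp.ofLp (Torus.abcCoeff A B C s))
          (Complex.I • crossProduct (fun j => (((-k - s) j : ℤ) : ℂ)) (WithLp.ofLp (c (-k - s))) -
            WithLp.ofLp (c (-k - s)))) : EuclideanSpace ℂ (Fin 3)))) := by
  rw [crossForm_conj A B C c k, conjVec_sub, conjVec_smul, Complex.conj_ofReal, freqNormSq_neg,
    ← lerayCoeff_neg_conjVec (-k), neg_neg]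

/-- **Conjugate eigenpairs.** If `c` solves the certifiers' eigen-equation
`−(|k|²/R) c(k) + Π_k X c(k) = λ c(k)` for all `k`, then `Jc = conj c(−·)` solves it with `conj λ`
(any `A, B, C`, real `R`). In particular non-real eigenvalues of the real operator come in conjugate
pairs, and for real `λ` the conjugate-symmetric families `c + Jc`, `i(c − Jc)` are again solutions. -/
theorem certifier_eigen_conj (A B C R : ℝ) (lam : ℂ) (c : (Fin 3 → ℤ) → EuclideanSpace ℂ (Fin 3))
    (heq : ∀ k : Fin 3 → ℤ,
      -(((freqNormSq k / R : ℝ)) : ℂ) • c k +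
        Torus.lerayCoeff k (∑ s ∈ Torus.abcFreq, (WithLp.toLp 2 (crossProduct
          (WithLp.ofLp (Torus.abcCoeff A B C s))
          (Complex.I • crossProduct (fun j => (((k - s) j : ℤ) : ℂ)) (WithLp.ofLp (c (k - s))) -
            WithLp.ofLp (c (k - s)))) : EuclideanSpace ℂ (Fin 3))) = lam • c k)
    (k : Fin 3 → ℤ) :
    -(((freqNormSq k / R : ℝ)) : ℂ) • conjVec (c (-k)) +
        Torus.lerayCoeff k (∑ s ∈ Torus.abcFreq, (WithLp.toLp 2 (crossProduct
          (WithLp.ofLp (Torus.abcCoeff A B C s))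
          (Complex.I • crossProduct (fun j => (((k - s) j : ℤ) : ℂ)) (WithLp.ofLp (conjVec (c (-(k - s))))) -
            WithLp.ofLp (conjVec (c (-(k - s)))))) : EuclideanSpace ℂ (Fin 3))) =
      conj lam • conjVec (c (-k)) := by
  rw [crossForm_conj A B C c k, ← neg_neg k, lerayCoeff_neg_conjVec (-k), neg_neg,
    ← conjVec_smul, ← heq (-k), conjVec_add, conjVec_smul, freqNormSq_neg, map_neg, Complex.conj_ofReal]

/-! ## §4 Linearity of `X` and conjugate-symmetric eigenfamilies for real eigenvalues -/

/-- `X` is additive in the coefficient family (cross products are bilinear). [folklore] -/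
theorem crossForm_add (A B C : ℝ) (c d : (Fin 3 → ℤ) → EuclideanSpace ℂ (Fin 3)) (k : Fin 3 → ℤ) :
    (∑ s ∈ Torus.abcFreq, (WithLp.toLp 2 (crossProduct (WithLp.ofLp (Torus.abcCoeff A B C s))
        (Complex.I • crossProduct (fun j => (((k - s) j : ℤ) : ℂ)) (WithLp.ofLp (c (k - s) + d (k - s))) -
          WithLp.ofLp (c (k - s) + d (k - s)))) : EuclideanSpace ℂ (Fin 3))) =
      (∑ s ∈ Torus.abcFreq, (WithLp.toLp 2 (crossProduct (WithLp.ofLp (Torus.abcCoeff A B C s))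
        (Complex.I • crossProduct (fun j => (((k - s) j : ℤ) : ℂ)) (WithLp.ofLp (c (k - s))) -
          WithLp.ofLp (c (k - s)))) : EuclideanSpace ℂ (Fin 3))) +
      ∑ s ∈ Torus.abcFreq, (WithLp.toLp 2 (crossProduct (WithLp.ofLp (Torus.abcCoeff A B C s))
        (Complex.I • crossProduct (fun j => (((k - s) j : ℤ) : ℂ)) (WithLp.ofLp (d (k - s))) -
          WithLp.ofLp (d (k - s)))) : EuclideanSpace ℂ (Fin 3)) := by
  rw [← Finset.sum_add_distrib]
  refine Finset.sum_congr rfl fun s _ => ?_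
  rw [WithLp.ofLp_add, map_add, smul_add, add_sub_add_comm, map_add, WithLp.toLp_add]

/-- `X` is homogeneous in the coefficient family. [folklore] -/
theorem crossForm_smul (A B C : ℝ) (a : ℂ) (c : (Fin 3 → ℤ) → EuclideanSpace ℂ (Fin 3)) (k : Fin 3 → ℤ) :
    (∑ s ∈ Torus.abcFreq, (WithLp.toLp 2 (crossProduct (WithLp.ofLp (Torus.abcCoeff A B C s))
        (Complex.I • crossProduct (fun j => (((k - s) j : ℤ) : ℂ)) (WithLp.ofLp (a • c (k - s))) -
          WithLp.ofLp (a • c (k - s)))) : EuclideanSpace ℂ (Fin 3))) =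
      a • ∑ s ∈ Torus.abcFreq, (WithLp.toLp 2 (crossProduct (WithLp.ofLp (Torus.abcCoeff A B C s))
        (Complex.I • crossProduct (fun j => (((k - s) j : ℤ) : ℂ)) (WithLp.ofLp (c (k - s))) -
          WithLp.ofLp (c (k - s)))) : EuclideanSpace ℂ (Fin 3)) := by
  rw [Finset.smul_sum]
  refine Finset.sum_congr rfl fun s _ => ?_
  rw [WithLp.ofLp_smul, map_smul, smul_comm Complex.I a, ← smul_sub, map_smul, WithLp.toLp_smul]

/-- `X` respects differences of coefficient families. [folklore] -/
theorem crossForm_sub (A B C : ℝ) (c d : (Fin 3 → ℤ) → EuclideanSpace ℂ (Fin 3)) (k : Fin 3 → ℤ) :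
    (∑ s ∈ Torus.abcFreq, (WithLp.toLp 2 (crossProduct (WithLp.ofLp (Torus.abcCoeff A B C s))
        (Complex.I • crossProduct (fun j => (((k - s) j : ℤ) : ℂ)) (WithLp.ofLp (c (k - s) - d (k - s))) -
          WithLp.ofLp (c (k - s) - d (k - s)))) : EuclideanSpace ℂ (Fin 3))) =
      (∑ s ∈ Torus.abcFreq, (WithLp.toLp 2 (crossProduct (WithLp.ofLp (Torus.abcCoeff A B C s))
        (Complex.I • crossProduct (fun j => (((k - s) j : ℤ) : ℂ)) (WithLp.ofLp (c (k - s))) -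
          WithLp.ofLp (c (k - s)))) : EuclideanSpace ℂ (Fin 3))) -
      ∑ s ∈ Torus.abcFreq, (WithLp.toLp 2 (crossProduct (WithLp.ofLp (Torus.abcCoeff A B C s))
        (Complex.I • crossProduct (fun j => (((k - s) j : ℤ) : ℂ)) (WithLp.ofLp (d (k - s))) -
          WithLp.ofLp (d (k - s)))) : EuclideanSpace ℂ (Fin 3)) := by
  rw [← Finset.sum_sub_distrib]
  refine Finset.sum_congr rfl fun s _ => ?_
  rw [WithLp.ofLp_sub, map_sub (crossProduct (fun j => (((k - s) j : ℤ) : ℂ))), smul_sub, sub_sub_sub_comm,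
    map_sub, WithLp.toLp_sub]

/-- The symmetrised family `c + Jc` is conjugate-symmetric. [folklore] -/
theorem isConjSymm_add_conj (c : (Fin 3 → ℤ) → EuclideanSpace ℂ (Fin 3)) :
    IsConjSymm (fun m => c m + conjVec (c (-m))) := by
  intro k
  simp only [neg_neg, conjVec_add, conjVec_conjVec]
  exact add_comm _ _

/-- The family `i(c − Jc)` is conjugate-symmetric. [folklore] -/
theorem isConjSymm_I_smul_sub_conj (c : (Fin 3 → ℤ) → EuclideanSpace ℂ (Fin 3)) :
    IsConjSymm (fun m => Complex.I • (c m - conjVec (c (-m)))) := by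
  intro k
  simp only [neg_neg, conjVec_smul, conjVec_sub, conjVec_conjVec, Complex.conj_I]
  rw [neg_smul, ← smul_neg, neg_sub]

/-- A nonzero family has `c + Jc ≠ 0` or `i(c − Jc) ≠ 0` at the same frequency. [folklore] -/
theorem add_conj_ne_zero_or (c : (Fin 3 → ℤ) → EuclideanSpace ℂ (Fin 3)) {k : Fin 3 → ℤ}
    (hk : c k ≠ 0) :
    c k + conjVec (c (-k)) ≠ 0 ∨ Complex.I • (c k - conjVec (c (-k))) ≠ 0 := by
  by_contra h
  push Not at h
  obtain ⟨h1, h2⟩ := h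
  rw [smul_eq_zero] at h2
  rcases h2 with hI | h2
  · exact Complex.I_ne_zero hI
  · apply hk
    have e1 : conjVec (c (-k)) = -c k := eq_neg_of_add_eq_zero_right h1
    rw [e1, sub_neg_eq_add, ← two_smul ℂ] at h2
    exact (smul_eq_zero.mp h2).resolve_left two_ne_zero

/-- **A real eigenvalue of the real operator has a conjugate-symmetric (real) eigenfamily.** If
`c ≢ 0` solves `−(|k|²/R) c(k) + Π_k X c(k) = λ c(k)` with `λ ∈ ℝ`, then one of the
conjugate-symmetric families `c + Jc`, `i(c − Jc)` is a non-zero solution of the same equation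
(`certifier_eigen_conj` + linearity). This is the lattice form of «real eigenvector» in
`SkewCutSchurCoercivity.exists_eigenvalue_of_certificate`; any `A, B, C`, real `R`. -/
theorem exists_isConjSymm_eigenfamily (A B C R lam : ℝ) (c : (Fin 3 → ℤ) → EuclideanSpace ℂ (Fin 3))
    (hc : ∃ k, c k ≠ 0)
    (heq : ∀ k : Fin 3 → ℤ,
      -(((freqNormSq k / R : ℝ)) : ℂ) • c k +
        Torus.lerayCoeff k (∑ s ∈ Torus.abcFreq, (WithLp.toLp 2 (crossProduct
          (WithLp.ofLp (Torus.abcCoeff A B C s))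
          (Complex.I • crossProduct (fun j => (((k - s) j : ℤ) : ℂ)) (WithLp.ofLp (c (k - s))) -
            WithLp.ofLp (c (k - s)))) : EuclideanSpace ℂ (Fin 3))) = (lam : ℂ) • c k) :
    ∃ d : (Fin 3 → ℤ) → EuclideanSpace ℂ (Fin 3), (∃ k, d k ≠ 0) ∧ IsConjSymm d ∧
      ∀ k : Fin 3 → ℤ,
        -(((freqNormSq k / R : ℝ)) : ℂ) • d k +
          Torus.lerayCoeff k (∑ s ∈ Torus.abcFreq, (WithLp.toLp 2 (crossProduct
            (WithLp.ofLp (Torus.abcCoeff A B C s))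
            (Complex.I • crossProduct (fun j => (((k - s) j : ℤ) : ℂ)) (WithLp.ofLp (d (k - s))) -
              WithLp.ofLp (d (k - s)))) : EuclideanSpace ℂ (Fin 3))) = (lam : ℂ) • d k := by
  obtain ⟨k₀, hk₀⟩ := hc
  -- the conjugate family solves the equation with `conj λ = λ`
  have hJ : ∀ k : Fin 3 → ℤ,
      -(((freqNormSq k / R : ℝ)) : ℂ) • conjVec (c (-k)) +
        Torus.lerayCoeff k (∑ s ∈ Torus.abcFreq, (WithLp.toLp 2 (crossProduct
          (WithLp.ofLp (Torus.abcCoeff A B C s))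
          (Complex.I • crossProduct (fun j => (((k - s) j : ℤ) : ℂ)) (WithLp.ofLp (conjVec (c (-(k - s))))) -
            WithLp.ofLp (conjVec (c (-(k - s)))))) : EuclideanSpace ℂ (Fin 3))) =
        (lam : ℂ) • conjVec (c (-k)) := by
    intro k
    have h := certifier_eigen_conj A B C R (lam : ℂ) c heq k
    rwa [Complex.conj_ofReal] at h
  -- the two candidate real families both solve the equation
  have hd1 : ∀ k : Fin 3 → ℤ,
      -(((freqNormSq k / R : ℝ)) : ℂ) • (c k + conjVec (c (-k))) +
        Torus.lerayCoeff k (∑ s ∈ Torus.abcFreq, (WithLp.toLp 2 (crossProduct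
          (WithLp.ofLp (Torus.abcCoeff A B C s))
          (Complex.I • crossProduct (fun j => (((k - s) j : ℤ) : ℂ))
            (WithLp.ofLp (c (k - s) + conjVec (c (-(k - s))))) -
            WithLp.ofLp (c (k - s) + conjVec (c (-(k - s)))))) : EuclideanSpace ℂ (Fin 3))) =
        (lam : ℂ) • (c k + conjVec (c (-k))) := by
    intro k
    rw [crossForm_add A B C c (fun m => conjVec (c (-m))) k, lerayCoeff_add', smul_add, smul_add,
      ← heq k, ← hJ k]
    abel
  have hd2 : ∀ k : Fin 3 → ℤ,
      -(((freqNormSq k / R : ℝ)) : ℂ) • (Complex.I • (c k - conjVec (c (-k)))) +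
        Torus.lerayCoeff k (∑ s ∈ Torus.abcFreq, (WithLp.toLp 2 (crossProduct
          (WithLp.ofLp (Torus.abcCoeff A B C s))
          (Complex.I • crossProduct (fun j => (((k - s) j : ℤ) : ℂ))
            (WithLp.ofLp (Complex.I • (c (k - s) - conjVec (c (-(k - s)))))) -
            WithLp.ofLp (Complex.I • (c (k - s) - conjVec (c (-(k - s))))))) : EuclideanSpace ℂ (Fin 3))) =
        (lam : ℂ) • (Complex.I • (c k - conjVec (c (-k)))) := by
    intro k
    rw [crossForm_smul A B C Complex.I (fun m => c m - conjVec (c (-m))) k,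
      crossForm_sub A B C c (fun m => conjVec (c (-m))) k, lerayCoeff_smul', lerayCoeff_sub',
      smul_comm (-(((freqNormSq k / R : ℝ)) : ℂ)) Complex.I, ← smul_add, smul_sub, sub_add_sub_comm,
      heq k, hJ k, ← smul_sub, smul_comm]
  rcases add_conj_ne_zero_or c hk₀ with h1 | h2
  · exact ⟨fun m => c m + conjVec (c (-m)), ⟨k₀, h1⟩, isConjSymm_add_conj c, hd1⟩
  · exact ⟨fun m => Complex.I • (c m - conjVec (c (-m))), ⟨k₀, h2⟩, isConjSymm_I_smul_sub_conj c, hd2⟩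

end Summit.NavierStokesRegularity.FluidComputer.AbcLatticeReality

end
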